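import Literature.NumberTheory.GaloisRepresentations.LubinTateColemanCoordMomentsBasisTwo
import Literature.NumberTheory.GaloisRepresentations.PowerSeriesTopNilpotentEvalZeros
import HarnessLib

/-!
# The weights SEPARATE the Coleman coordinate module (`q = 2`): an element of `M ≅ Λ·1 ⊕ Λ·σ_{−1}(1)` whose `Λ[Δ]`-coordinate vanishes at
# infinitely many characters `κ^{k+1}` of EACH parity is `0`; hence `r ∈ M` is determined by its moments `mom_k(r)` (at weights with `mom_k(1) ≠ 0`)

De Shalit, *Iwasawa theory of elliptic curves with complex multiplication* (1987), Ch. I §3.1 (`ℤ_p⟦𝒢⟧ = Λ[Δ]`), §3.5 (11) (the moments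
`∫ κ^k dμ_β = D^k log g_β(0)` determine `μ_β`), III §1.11 (18) (finitely many zeros of a characteristic power series); Washington §7.1.  With
`LubinTateColemanCoordMomentsBasisTwo` (`mom_k(r) = (c₀(a_k) + (−1)^{k+1} c₁(a_k))·mom_k(1)`, `a_k = γ^{k+1} − 1`, `(c₀, c₁)` the `Λ[Δ]`-coordinates)
and `PowerSeriesTopNilpotentEvalZeros` (a non-zero power series over a complete DVR has finitely many zeros in `(π)`), THIS file proves the
SEPARATION statements by which any comparison of the Coleman lane with de Shalit's measure `i` can be PINNED by moments (0 sorry, no defs):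

* §1 `injective_weight` (**`k ↦ a_k = γ^{k+1} − 1` is injective** when `k ↦ γ^{k+1}` is — e.g. `γ = 1 + 4w` over
  `ℚ₂`), `algebraMap_ltCoeff_pi_ne_zero`;
* §2 ★★ `eq_zero_of_infinite_even_odd` — for `r ∈ M`: if `c₀(a_k) + (−1)^{k+1} c₁(a_k) = 0` for infinitely many EVEN `k` and for infinitely
  many ODD `k`, then `r = 0` (`c₀ − c₁` and `c₀ + c₁` vanish at infinitely many points of `(π)` ⟹ both `0` ⟹ `c₀ = c₁ = 0` in characteristic `0`);
  `eq_of_infinite_even_odd` (two elements with the same character values agree);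
* §3 ★★ **`eq_zero_of_forall_coordMoment_eq_zero`** — if `mom_k(r) = 0` for all `k` in a set `K` of weights containing infinitely many of each
  parity and with `mom_k(1) ≠ 0` on `K`, then `r = 0`; ★★ **`eq_of_forall_coordMoment_eq`** — two elements of `M` with the same moments on such a
  `K` are EQUAL.  (At `k = 0, 1`: `mom_0(1) = 1`, `mom_1(1) = u⁻¹` by the prequel; the hypothesis `mom_k(1) ≠ 0` is the non-degeneracy of the
  universal constants `u⁻¹[X⁰]D_E^[k−1]ω_E`.)

Hypotheses (all dischargeable in the lane's degree-one situation `F = ℚ₂`, `E/F` unramified): `CharZero F`; `𝔪_{𝒪_E} = (π)` and `(π)`-adic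
completeness of `𝒪_E` (`isAdicComplete_span_algebraMap_pi`); injectivity of `k ↦ γ^{k+1}` (`γ = 1 + π²w` of infinite order).

## References
* E. de Shalit, *Iwasawa theory of elliptic curves with complex multiplication* (1987), Ch. I §3.1, §3.5 (11); Ch. III §1.11 (18). [deShalit1987]
* L. C. Washington, *Introduction to Cyclotomic Fields*, 2nd ed. (1997), §7.1, §13.2. [Washington1997]
-/

noncomputable section

open PowerSeries

namespace Literature.NumberTheory.GaloisRepresentations

section CoordMomentsSeparationTwo

open GaloisRepresentations.IsNonarchimedeanLocalField LubinTate ValuativeRel Field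

variable {F : Type} [Field F] [ValuativeRel F] [TopologicalSpace F] [IsNonarchimedeanLocalField F]

attribute [local instance] ltNormUniformSpace ltNormIsUniformAddGroup rk1 nF nE fintypeResidueField

variable {π : 𝒪[F]} (hπ : (valuation F).IsUniformizer (π : F))
variable (E : IntermediateField F (AlgebraicClosure F)) [FiniteDimensional F E]
variable (hq : residueFieldCard F = 2) (u : (LTCoeff F)ˣ) (hu : LTCoeff.of F π = residueFieldCard F * u) (γ : 𝒪[F]ˣ)

/-! ### §1. The weight sequence `a_k = γ^{k+1} − 1` is injective; `π ≠ 0` in `𝒪_E` -/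

/-- `𝒪_F → 𝒪_E` is injective. [folklore] -/
private theorem algebraMap_integer_injective' : Function.Injective (algebraMap 𝒪[F] (unitBall E)) := by
  intro x y h
  have h' := congrArg (fun s : unitBall E => (s : E)) h
  simp only [algebraMap_integer_apply] at h'
  exact Subtype.ext ((algebraMap F E).injective h')

/-- **The weights `a_k = γ^{k+1} − 1 ∈ 𝒪_E` are pairwise distinct** when `k ↦ γ^{k+1}` is injective (`γ` of infinite order, e.g.
`γ = 1 + 4w ∈ ℤ₂^×`). [cite: Washington1997, §13.2] -/
theorem injective_weight (hγinj : Function.Injective fun k : ℕ => (γ : 𝒪[F]) ^ (k + 1)) :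
    Function.Injective fun k : ℕ => algebraMap 𝒪[F] (unitBall E) (γ : 𝒪[F]) ^ (k + 1) - 1 := by
  intro i j h
  have h1 : algebraMap 𝒪[F] (unitBall E) ((γ : 𝒪[F]) ^ (i + 1)) = algebraMap 𝒪[F] (unitBall E) ((γ : 𝒪[F]) ^ (j + 1)) := by
    rw [map_pow, map_pow]; exact sub_left_injective h
  exact hγinj (algebraMap_integer_injective' E h1)

include hπ in
/-- `π ≠ 0` in `𝒪_E` (through the Lubin–Tate coefficient map). [cite: deShalit1987, Ch. I §1.7] -/
theorem algebraMap_ltCoeff_pi_ne_zero : algebraMap (LTCoeff F) (unitBall E) (LTCoeff.of F π) ≠ 0 :=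
  algebraMap_pi_ne_zero hπ E

/-! ### §2. Separation of the `Λ[Δ]`-coordinates by characters of both parities -/

variable [CharZero F]
  [IsAdicComplete (Ideal.span {algebraMap (LTCoeff F) (unitBall E) (LTCoeff.of F π)}) (unitBall E)]
  [IsAdicComplete (IsLocalRing.maximalIdeal (unitBall E)) (unitBall E)]
  (h𝔪 : IsLocalRing.maximalIdeal (unitBall E) = Ideal.span {algebraMap (LTCoeff F) (unitBall E) (LTCoeff.of F π)})
  (hreg : ∀ x : unitBall E, algebraMap (LTCoeff F) (unitBall E) (LTCoeff.of F π) * x = 0 → x = 0)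
  (w : 𝒪[F]ˣ) (hγ : (γ : 𝒪[F]) = 1 + π ^ 2 * w) (hγinj : Function.Injective fun k : ℕ => (γ : 𝒪[F]) ^ (k + 1))

omit [IsAdicComplete (IsLocalRing.maximalIdeal (unitBall E)) (unitBall E)]
  [IsAdicComplete (Ideal.span {algebraMap (LTCoeff F) (unitBall E) (LTCoeff.of F π)}) (unitBall E)] in
/-- In characteristic `0`: `c + c = 0 ⟹ c = 0` in `𝒪_E⟦T⟧`. [folklore] -/
private theorem eq_zero_of_add_self_eq_zero {c : PowerSeries (unitBall E)} (h : c + c = 0) : c = 0 := by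
  refine PowerSeries.ext fun n => ?_
  have hn := congrArg (fun s : unitBall E => (s : E)) (congrArg (PowerSeries.coeff n) h)
  simp only [map_add, map_zero, AddMemClass.coe_add, ZeroMemClass.coe_zero] at hn
  rw [map_zero]
  exact Subtype.ext (by rw [ZeroMemClass.coe_zero]; exact add_self_eq_zero.mp hn)

omit [CharZero F] in
include hπ h𝔪 hγinj in
/-- ★ **Separation in `Λ = 𝒪_E⟦T⟧` along the weights**: a power series vanishing at `a_k = γ^{k+1} − 1` for infinitely many `k` is `0`.
[cite: Washington1997, §7.1] [cite: deShalit1987, Ch. III §1.11 (18)] -/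
theorem eq_zero_of_infinite_setOf_tEval_weight_eq_zero {c : PowerSeries (unitBall E)}
    (hinf : {k : ℕ | tEval (algebraMap_unit_pow_sub_one_mem hπ E hq γ k) c = 0}.Infinite) : c = 0 :=
  eq_zero_of_infinite_setOf_tEval_apply_eq_zero h𝔪 (algebraMap_ltCoeff_pi_ne_zero hπ E)
    (fun k => algebraMap_unit_pow_sub_one_mem hπ E hq γ k) (injective_weight E γ hγinj) hinf

omit [CharZero F] in
include hπ h𝔪 hγinj in
/-- **Identity principle along the weights**: two elements of `𝒪_E⟦T⟧` agreeing at `a_k` for infinitely many `k` are equal. [cite: Washington1997, §7.1, §13.2] -/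
theorem eq_of_infinite_setOf_tEval_weight_eq {c c' : PowerSeries (unitBall E)}
    (hinf : {k : ℕ | tEval (algebraMap_unit_pow_sub_one_mem hπ E hq γ k) c = tEval (algebraMap_unit_pow_sub_one_mem hπ E hq γ k) c'}.Infinite) :
    c = c' :=
  eq_of_infinite_setOf_tEval_apply_eq h𝔪 (algebraMap_ltCoeff_pi_ne_zero hπ E) (fun k => algebraMap_unit_pow_sub_one_mem hπ E hq γ k)
    (injective_weight E γ hγinj) hinf

include hπ h𝔪 hγinj in
/-- ★ **Parity decoupling**: if `c₀(a_k) + (−1)^{k+1} c₁(a_k) = 0` for infinitely many EVEN and infinitely many ODD `k`, then `c₀ = c₁ = 0`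
(`c₀ − c₁` and `c₀ + c₁` vanish at infinitely many weights; characteristic `0`). [cite: deShalit1987, Ch. I §3.1] [cite: Washington1997, §7.1] -/
theorem eq_zero_and_eq_zero_of_infinite_even_odd {c₀ c₁ : PowerSeries (unitBall E)}
    (heven : {k : ℕ | Even k ∧ tEval (algebraMap_unit_pow_sub_one_mem hπ E hq γ k) c₀ +
      (-1) ^ (k + 1) * tEval (algebraMap_unit_pow_sub_one_mem hπ E hq γ k) c₁ = 0}.Infinite)
    (hodd : {k : ℕ | Odd k ∧ tEval (algebraMap_unit_pow_sub_one_mem hπ E hq γ k) c₀ +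
      (-1) ^ (k + 1) * tEval (algebraMap_unit_pow_sub_one_mem hπ E hq γ k) c₁ = 0}.Infinite) :
    c₀ = 0 ∧ c₁ = 0 := by
  -- even `k`: `c₀ − c₁` vanishes at `a_k`
  have hsub : c₀ - c₁ = 0 := by
    refine eq_zero_of_infinite_setOf_tEval_weight_eq_zero hπ E hq γ h𝔪 hγinj (heven.mono ?_)
    rintro k ⟨hk, h0⟩
    rw [Odd.neg_one_pow (Even.add_one hk), neg_one_mul, ← sub_eq_add_neg] at h0
    rw [Set.mem_setOf_eq, ← tEvalHom_apply, map_sub, tEvalHom_apply, tEvalHom_apply]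
    exact h0
  -- odd `k`: `c₀ + c₁` vanishes at `a_k`
  have hadd : c₀ + c₁ = 0 := by
    refine eq_zero_of_infinite_setOf_tEval_weight_eq_zero hπ E hq γ h𝔪 hγinj (hodd.mono ?_)
    rintro k ⟨hk, h0⟩
    rw [Even.neg_one_pow (Odd.add_one hk), one_mul] at h0
    rw [Set.mem_setOf_eq, ← tEvalHom_apply, map_add, tEvalHom_apply, tEvalHom_apply]
    exact h0
  have h0 : c₀ = c₁ := sub_eq_zero.mp hsub
  rw [h0] at hadd
  have h1 : c₁ = 0 := eq_zero_of_add_self_eq_zero E hadd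
  exact ⟨h0.trans h1, h1⟩

include h𝔪 hγinj in
/-- ★★ **SEPARATION OF `M ≅ Λ[Δ]` BY CHARACTERS OF BOTH PARITIES**: if the `Λ[Δ]`-coordinate `(c₀, c₁) = coordBasisDelta.repr r` of `r ∈ M`
satisfies `c₀(a_k) + (−1)^{k+1} c₁(a_k) = 0` for infinitely many EVEN `k` and for infinitely many ODD `k`, then `r = 0`.
[cite: deShalit1987, Ch. I §3.1, §3.5 (11)] [cite: Washington1997, §7.1] -/
theorem eq_zero_of_infinite_even_odd (r : ColemanCoordModule hπ hq (algebraMap (LTCoeff F) (unitBall E)) u hu γ)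
    {c₀ c₁ : PowerSeries (unitBall E)} (hc₀ : (coordBasisDelta hπ hq (algebraMap (LTCoeff F) (unitBall E)) u hu γ hreg w hγ).repr r 0 = c₀)
    (hc₁ : (coordBasisDelta hπ hq (algebraMap (LTCoeff F) (unitBall E)) u hu γ hreg w hγ).repr r 1 = c₁)
    (heven : {k : ℕ | Even k ∧ tEval (algebraMap_unit_pow_sub_one_mem hπ E hq γ k) c₀ +
      (-1) ^ (k + 1) * tEval (algebraMap_unit_pow_sub_one_mem hπ E hq γ k) c₁ = 0}.Infinite)
    (hodd : {k : ℕ | Odd k ∧ tEval (algebraMap_unit_pow_sub_one_mem hπ E hq γ k) c₀ +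
      (-1) ^ (k + 1) * tEval (algebraMap_unit_pow_sub_one_mem hπ E hq γ k) c₁ = 0}.Infinite) :
    r = 0 := by
  obtain ⟨h0, h1⟩ := eq_zero_and_eq_zero_of_infinite_even_odd hπ E hq γ h𝔪 hγinj heven hodd
  rw [eq_repr_zero_smul_one_add_repr_one_smul hπ hq (algebraMap (LTCoeff F) (unitBall E)) u hu γ hreg w hγ r, hc₀, hc₁, h0, h1, zero_smul,
    zero_smul, add_zero]

/-! ### §3. Separation by MOMENTS -/

include h𝔪 hreg w hγ hγinj in
/-- ★★ **`r ∈ M` IS DETERMINED BY ITS MOMENTS**: if `mom_k(r) = 0` for every `k` in a set `K` of weights containing infinitely many even and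
infinitely many odd `k`, and the universal constants `mom_k(1)` (`= u⁻¹[X⁰]D_E^[k−1]ω_E`) are non-zero on `K`, then `r = 0`.
[cite: deShalit1987, Ch. I §3.5 (11)] [cite: Washington1997, §7.1] -/
theorem eq_zero_of_forall_coordMoment_eq_zero (r : ColemanCoordModule hπ hq (algebraMap (LTCoeff F) (unitBall E)) u hu γ) (K : Set ℕ)
    (hKeven : {k ∈ K | Even k}.Infinite) (hKodd : {k ∈ K | Odd k}.Infinite) (hm : ∀ k ∈ K, coordMoment hπ E u k 1 ≠ 0)
    (h0 : ∀ k ∈ K, coordMoment hπ E u k (TActModule.toPS r) = 0) : r = 0 := by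
  have hvan : ∀ k ∈ K, tEval (algebraMap_unit_pow_sub_one_mem hπ E hq γ k)
        ((coordBasisDelta hπ hq (algebraMap (LTCoeff F) (unitBall E)) u hu γ hreg w hγ).repr r 0) +
      (-1) ^ (k + 1) * tEval (algebraMap_unit_pow_sub_one_mem hπ E hq γ k)
        ((coordBasisDelta hπ hq (algebraMap (LTCoeff F) (unitBall E)) u hu γ hreg w hγ).repr r 1) = 0 := by
    intro k hk
    have h := h0 k hk
    rw [coordMoment_eq_repr_coordBasisDelta hπ E hq u hu γ hreg w hγ] at h
    exact (mul_eq_zero.mp h).resolve_right (hm k hk)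
  exact eq_zero_of_infinite_even_odd hπ E hq u hu γ h𝔪 hreg w hγ hγinj r rfl rfl
    (hKeven.mono fun k hk => And.intro hk.2 (hvan k hk.1)) (hKodd.mono fun k hk => And.intro hk.2 (hvan k hk.1))

include h𝔪 hreg w hγ hγinj in
/-- ★★ **TWO ELEMENTS OF `M` WITH THE SAME MOMENTS ARE EQUAL** (moments on a set `K` of weights with infinitely many of each parity and
`mom_k(1) ≠ 0` on `K`) — the pinning principle for the junction of the Coleman lane with de Shalit's measure `i`.
[cite: deShalit1987, Ch. I §3.5 (11)] [cite: Washington1997, §7.1, §13.2] -/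
theorem eq_of_forall_coordMoment_eq (r r' : ColemanCoordModule hπ hq (algebraMap (LTCoeff F) (unitBall E)) u hu γ) (K : Set ℕ)
    (hKeven : {k ∈ K | Even k}.Infinite) (hKodd : {k ∈ K | Odd k}.Infinite) (hm : ∀ k ∈ K, coordMoment hπ E u k 1 ≠ 0)
    (h : ∀ k ∈ K, coordMoment hπ E u k (TActModule.toPS r) = coordMoment hπ E u k (TActModule.toPS r')) : r = r' := by
  refine sub_eq_zero.mp (eq_zero_of_forall_coordMoment_eq_zero hπ E hq u hu γ h𝔪 hreg w hγ hγinj (r - r') K hKeven hKodd hm fun k hk => ?_)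
  rw [map_sub, ← coordMomentₗ_apply, map_sub, coordMomentₗ_apply, coordMomentₗ_apply, h k hk, sub_self]

end CoordMomentsSeparationTwo

end Literature.NumberTheory.GaloisRepresentations
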